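import Mathlib
import Summits.ResolutionOfSingularities.ResolutionOfSingularities.Theorems.FrobeniusLadderFRationalResolutionCompletedBaseChangeFibreStalks
import Summits.ResolutionOfSingularities.ResolutionOfSingularities.Theorems.FrobeniusLadderFRationalResolutionCompletedBaseChangeFibreLocalization
import Summits.ResolutionOfSingularities.ResolutionOfSingularities.Theorems.FrobeniusLadderFRationalResolutionCompletedBaseChangeFibreChart
import Literature.AlgebraicGeometry.Resolution.BlowupChartTransition

/-!
# Crux `FrobeniusLadder.FRationalResolution` (stmt-ResolutionOfSingularities-15317), line `redirect`,
# stub `stub_diagonalizableQuotientResolution` — THE DOWN DIRECTION for the two-step ÉTALE descent (ε): two-step data on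
# `Bl_{IC_𝔮}(Spec C_𝔮)` (the blow-up of the LOCAL ring `𝒪_{Y,y} = C_𝔮`) give two-step data on `Bl_I(Spec C)` over `𝔮`

Files 5/6 of the (T) series go UP (model chart facts ⇒ facts on the blow-up over the completion). The étale descent (ε) of
MEMO-15317-leafhand2-g23 §3 reads its data on `X₁' = Bl_{IC_𝔮}(Spec C_𝔮)` — the blow-up of the local ring of the étale chart at the
point — and needs them on `X₁ = Bl_I(Spec C)` near `𝔮`, `C` of finite type over a field, `𝔮` maximal, `I = (x₁, …, x_n)`:
* `exists_point_ringEquiv_stalk_of_prime` — a prime `𝔑` of the chart ring `C[I/x_i] ⊗_C C_𝔮` gives a point `w` of `X₁'` with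
  `𝒪_{X₁',w} ≅ (C[I/x_i] ⊗_C C_𝔮)_𝔑` (`…Chart.exists_ringEquiv_tensor_blowupAlgebra` + `…Stalks.nonempty_ringEquiv_stalk_awayι`);
* ★★★ **`hloc_stalk_down`** — if `Bl_{𝔪_w}(Spec 𝒪_{X₁',w})` is regular at every non-regular point `w` of `X₁'`, then
  `Bl_{𝔪_z}(Spec 𝒪_{X₁,z})` is regular at every non-regular point `z` of `X₁` over `V(𝔮)`: `𝒪_{X₁,z} ≅ C[I/x_i]_{𝔫'}`
  (`…Points.exists_chart_prime_ringEquiv_stalk`), the unique prime `𝔑` of `C[I/x_i] ⊗_C C_𝔮` over `𝔫'` gives a point `w` of `X₁'` with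
  `𝒪_{X₁',w} ≅ (C[I/x_i] ⊗_C C_𝔮)_𝔑` and the same regularity; `Bl_𝔪` regularity goes from `w` down through
  `((C[I/x_i] ⊗_C C_𝔮)_𝔑)^ ≅ (C[I/x_i]_{𝔫'})^` (`…Flat.exists_ringEquiv_adicCompletion`; the tensor is a LOCALIZATION of the
  finite-type `C[I/x_i]`, hence a G-ring: `…Stalks.isRegular_affineBlowup_maximalIdeal_of_isLocalization_of_ringEquiv_adicCompletion`).
The finiteness half of the DOWN transfer is chart-level `…Localization.finite_not_isRegularLocalRing_of_finite_localization`
(scheme-level packaging as in `…Finite` is left to (ε)); with `…Transport.hfin_hloc_of_ringEquiv` (`𝒪_{Y,y} ≅ C_𝔮`),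
`…EtaleBlowupComparison` and `…TwoStepHloc` this leaves the affine-open bookkeeping of (ε).

Honest label: plumbing toward ONE leaf stub (no stub, crux or summit closed). No definitions, no named facts, no sorry.
[cite: StacksProject, Tag 0804; Tag 02C5] [cite: Matsumura1987, Thm. 4.2; Thm. 8.14; Thm. 23.7; §32] [cite: GortzWedhorn2020, (13.19) p. 415]
-/

noncomputable section

-- single-problem summit: the doubled namespace component is forced
set_option linter.dupNamespace false

open IsLocalRing AlgebraicGeometry CategoryTheory
open scoped TensorProduct
open Literature.AlgebraicGeometry.Resolution

namespace Summit.ResolutionOfSingularities.ResolutionOfSingularities.Theorems.FRationalResolution.CompletedBaseChangeFibreDown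

/-- The point of `Bl_{IC_𝔮}(Spec C_𝔮)` on the chart `D₊(x_i t)` attached to a prime of the chart ring `C[I/x_i] ⊗_C C_𝔮 ≅ C_𝔮[IC_𝔮/x_i]`,
with its stalk and its regularity: for a prime `𝔑` of `C[I/x_i] ⊗_C C_𝔮` there is a point `w` of `Bl_{IC_𝔮}(Spec C_𝔮)` with
`𝒪_w ≅ (C[I/x_i] ⊗_C C_𝔮)_𝔑`. [cite: StacksProject, Tag 0804] [cite: GortzWedhorn2020, (13.19) p. 415] -/
theorem exists_point_ringEquiv_stalk_of_prime (C : Type) [CommRing C] (𝔮 : Ideal C) [𝔮.IsMaximal]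
    {n : ℕ} (x : Fin n → C) (I : Ideal C) (hI : I = Ideal.span (Set.range x)) (i : Fin n)
    (𝔑 : Ideal (blowupAlgebra I (x i) ⊗[C] Localization.AtPrime 𝔮)) [𝔑.IsPrime] :
    ∃ w : affineBlowup (I.map (algebraMap C (Localization.AtPrime 𝔮))),
      Nonempty ((affineBlowup (I.map (algebraMap C (Localization.AtPrime 𝔮)))).presheaf.stalk w ≃+*
        Localization.AtPrime 𝔑) := by
  haveI := CompletedBaseChangeFibreLocalization.flat_localization_atPrime C 𝔮
  have hxI : algebraMap C (Localization.AtPrime 𝔮) (x i) ∈ I.map (algebraMap C (Localization.AtPrime 𝔮)) :=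
    Ideal.mem_map_of_mem _ (hI ▸ Ideal.subset_span ⟨i, rfl⟩)
  obtain ⟨Θ, -, -⟩ := CompletedBaseChangeFibreChart.exists_ringEquiv_tensor_blowupAlgebra I
    (I.map (algebraMap C (Localization.AtPrime 𝔮))) (x i) le_rfl le_rfl
  -- the prime of `C_𝔮[IC_𝔮/x_i]` and the chart point
  haveI h𝔑' : (𝔑.comap Θ.symm.toRingHom).IsPrime := Ideal.comap_isPrime _ _
  have hmem' : ∀ s, s ∈ 𝔑.comap Θ.symm.toRingHom ↔ Θ.symm s ∈ 𝔑 := fun _ => Iff.rfl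
  let q : Spec (.of (HomogeneousLocalization.Away (reesGrading (I.map (algebraMap C (Localization.AtPrime 𝔮))))
      (reesT (algebraMap C (Localization.AtPrime 𝔮) (x i)) hxI))) :=
    PrimeSpectrum.comap (reesChartEquiv (I := I.map (algebraMap C (Localization.AtPrime 𝔮)))
      (algebraMap C (Localization.AtPrime 𝔮) (x i)) hxI).toRingHom ⟨𝔑.comap Θ.symm.toRingHom, h𝔑'⟩
  have hmemq : ∀ s, s ∈ q.asIdeal ↔ reesChartEquiv (I := I.map (algebraMap C (Localization.AtPrime 𝔮)))
      (algebraMap C (Localization.AtPrime 𝔮) (x i)) hxI s ∈ 𝔑.comap Θ.symm.toRingHom := fun _ => Iff.rfl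
  obtain ⟨e_w⟩ := CompletedBaseChangeFibreStalks.nonempty_ringEquiv_stalk_awayι
    (I.map (algebraMap C (Localization.AtPrime 𝔮))) (algebraMap C (Localization.AtPrime 𝔮) (x i)) hxI q
    (𝔑.comap Θ.symm.toRingHom) hmemq
  -- localizations along `Θ`
  have hP : ∀ s : blowupAlgebra I (x i) ⊗[C] Localization.AtPrime 𝔮, s ∈ 𝔑 ↔ Θ s ∈ 𝔑.comap Θ.symm.toRingHom := by
    intro s
    rw [hmem', RingEquiv.symm_apply_apply]
  obtain ⟨e₃⟩ := @CompletedBaseChangeFibrePoints.nonempty_ringEquiv_localization_of_ringEquiv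
    (blowupAlgebra I (x i) ⊗[C] Localization.AtPrime 𝔮) _ _ _ Θ 𝔑 inferInstance (𝔑.comap Θ.symm.toRingHom) h𝔑' hP
  exact ⟨_, ⟨e_w.trans e₃.symm⟩⟩

/-- ★★★ **`hloc` DOWN from the localization.** `C` of finite type over a field `K`, `𝔮` maximal, `I = (x₁, …, x_n)`: if the point
blow-up `Bl_{𝔪_w}(Spec 𝒪_w)` is regular at every non-regular point `w` of `Bl_{IC_𝔮}(Spec C_𝔮)`, then `Bl_{𝔪_z}(Spec 𝒪_z)` is regular at
every non-regular point `z` of `Bl_I(Spec C)` over `V(𝔮)`. [cite: Matsumura1987, Thm. 8.14; Thm. 23.7; §32] [cite: StacksProject, Tag 0804] -/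
theorem hloc_stalk_down (K : Type) [Field K] (C : Type) [CommRing C] [Algebra K C] [Algebra.FiniteType K C]
    (𝔮 : Ideal C) [𝔮.IsMaximal] {n : ℕ} (x : Fin n → C) (I : Ideal C) (hI : I = Ideal.span (Set.range x))
    (hloc' : ∀ w : affineBlowup (I.map (algebraMap C (Localization.AtPrime 𝔮))),
      ¬ IsRegularLocalRing ((affineBlowup (I.map (algebraMap C (Localization.AtPrime 𝔮)))).presheaf.stalk w) →
      Scheme.IsRegular (affineBlowup (R := (affineBlowup (I.map (algebraMap C (Localization.AtPrime 𝔮)))).presheaf.stalk w)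
        (maximalIdeal _)))
    (z : affineBlowup I) (hz𝔮 : 𝔮 ≤ (affineBlowup.π I z).asIdeal)
    (hz : ¬ IsRegularLocalRing ((affineBlowup I).presheaf.stalk z)) :
    Scheme.IsRegular (affineBlowup (R := (affineBlowup I).presheaf.stalk z) (maximalIdeal _)) := by
  haveI : IsNoetherianRing C := Algebra.FiniteType.isNoetherianRing K C
  haveI := CompletedBaseChangeFibreLocalization.flat_localization_atPrime C 𝔮
  have hres := CompletedBaseChangeFibreLocalization.forall_exists_sub_mem_localization_atPrime C 𝔮
  have hinj := CompletedBaseChangeFibreLocalization.comap_map_le_localization_atPrime C 𝔮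
  -- the chart of `z`
  have hxI : ∀ i, x i ∈ I := fun i => hI ▸ Ideal.subset_span ⟨i, rfl⟩
  have hIle : I ≤ Ideal.span (Set.range x) := hI.le
  obtain ⟨i, 𝔫', h𝔫'p, hcomap, hiff, ⟨e_z⟩⟩ :=
    CompletedBaseChangeFibrePoints.exists_chart_prime_ringEquiv_stalk I x hxI hIle z
  haveI := h𝔫'p
  have hxI' : algebraMap C (Localization.AtPrime 𝔮) (x i) ∈ I.map (algebraMap C (Localization.AtPrime 𝔮)) :=
    Ideal.mem_map_of_mem _ (hxI i)
  haveI : IsNoetherianRing (blowupAlgebra I (x i)) := isNoetherianRing_blowupAlgebra_of_isNoetherianRing I (x i)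
  haveI : IsNoetherianRing (blowupAlgebra (I.map (algebraMap C (Localization.AtPrime 𝔮)))
      (algebraMap C (Localization.AtPrime 𝔮) (x i))) :=
    isNoetherianRing_blowupAlgebra_of_isNoetherianRing _ _
  haveI : Algebra.FiniteType C (blowupAlgebra I (x i)) := finiteType_blowupAlgebra I (x i) (IsNoetherian.noetherian I)
  letI : Algebra K (blowupAlgebra I (x i)) := ((algebraMap C (blowupAlgebra I (x i))).comp (algebraMap K C)).toAlgebra
  haveI : IsScalarTower K C (blowupAlgebra I (x i)) := IsScalarTower.of_algebraMap_eq (fun _ => rfl)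
  haveI : Algebra.FiniteType K (blowupAlgebra I (x i)) := Algebra.FiniteType.trans (S := C) inferInstance inferInstance
  have h𝔫 : 𝔮.map (algebraMap C (blowupAlgebra I (x i))) ≤ 𝔫' := by
    rw [Ideal.map_le_iff_le_comap, hcomap]
    exact hz𝔮
  -- the chart rings: `Θ : C[I/x_i] ⊗ C_𝔮 ≅ C_𝔮[IC_𝔮/x_i]`, and the prime `𝔑'` upstairs over `𝔫'`
  obtain ⟨Θ, hΘ, -⟩ := CompletedBaseChangeFibreChart.exists_ringEquiv_tensor_blowupAlgebra I
    (I.map (algebraMap C (Localization.AtPrime 𝔮))) (x i) le_rfl le_rfl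
  obtain ⟨𝔑', ⟨h𝔑'p, h𝔑'c⟩, -⟩ := CompletedBaseChangeFibreChart.existsUnique_isPrime_comap_eq_blowupAlgebra I
    (I.map (algebraMap C (Localization.AtPrime 𝔮))) (x i) le_rfl le_rfl 𝔮 hres hinj 𝔫' h𝔫
  haveI := h𝔑'p
  subst h𝔑'c
  -- the point `w` of `Bl_{IC_𝔮}(Spec C_𝔮)` on the chart, with its stalk
  obtain ⟨e_w⟩ := CompletedBaseChangeFibreStalks.nonempty_ringEquiv_stalk_awayι
    (I.map (algebraMap C (Localization.AtPrime 𝔮))) (algebraMap C (Localization.AtPrime 𝔮) (x i)) hxI'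
    (PrimeSpectrum.comap (reesChartEquiv (I := I.map (algebraMap C (Localization.AtPrime 𝔮)))
      (algebraMap C (Localization.AtPrime 𝔮) (x i)) hxI').toRingHom ⟨𝔑', h𝔑'p⟩) 𝔑' (fun _ => Iff.rfl)
  -- `w` is singular
  have hregiff := CompletedBaseChangeFibreChart.isRegularLocalRing_iff_blowupAlgebra I
    (I.map (algebraMap C (Localization.AtPrime 𝔮))) (x i) le_rfl le_rfl 𝔮 hres 𝔑' h𝔫
  have hw : ¬ IsRegularLocalRing ((affineBlowup (I.map (algebraMap C (Localization.AtPrime 𝔮)))).presheaf.stalk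
      (Proj.awayι (reesGrading (I.map (algebraMap C (Localization.AtPrime 𝔮))))
        (reesT (algebraMap C (Localization.AtPrime 𝔮) (x i)) hxI')
        (reesT_mem (algebraMap C (Localization.AtPrime 𝔮) (x i)) hxI') one_pos
        (PrimeSpectrum.comap (reesChartEquiv (I := I.map (algebraMap C (Localization.AtPrime 𝔮)))
          (algebraMap C (Localization.AtPrime 𝔮) (x i)) hxI').toRingHom ⟨𝔑', h𝔑'p⟩))) := by
    intro h
    apply hz
    haveI : IsRegularLocalRing (Localization.AtPrime 𝔑') := IsRegularLocalRing.of_ringEquiv (R' := Localization.AtPrime 𝔑') e_w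
    exact hiff.mpr (hregiff.mpr inferInstance)
  have h1 := CompletedBaseChangeFibrePoints.isRegular_affineBlowup_maximalIdeal_of_ringEquiv (S := Localization.AtPrime 𝔑') e_w
    (hloc' _ hw)
  -- completions `(C[I/x_i]_{ψ⁻¹𝔑'})^ ≅ (C_𝔮[IC_𝔮/x_i]_{𝔑'})^` and the G-ring descent
  obtain ⟨ê, -⟩ := CompletedBaseChangeFibreCompletion.exists_ringEquiv_adicCompletion_of_presentation
    (B := Localization.AtPrime 𝔮) 𝔮 hres _ Θ hΘ 𝔑' h𝔫
  have hB : IsGRing (blowupAlgebra I (x i) ⊗[C] Localization.AtPrime 𝔮) :=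
    Matsumura1987_32_localization_holds.{0} (blowupAlgebra I (x i)) (blowupAlgebra I (x i) ⊗[C] Localization.AtPrime 𝔮)
      (Algebra.algebraMapSubmonoid (blowupAlgebra I (x i)) 𝔮.primeCompl) inferInstance
      (Matsumura1987_32_6_cor_holds.{0} K (blowupAlgebra I (x i)) inferInstance)
  have hB' := IsGRing.of_ringEquiv Θ hB
  haveI : IsNoetherianRing (Localization.AtPrime
      (𝔑'.comap (blowupAlgebraMap (algebraMap C (Localization.AtPrime 𝔮)) I
        (I.map (algebraMap C (Localization.AtPrime 𝔮))) (x i) le_rfl))) :=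
    IsLocalization.isNoetherianRing (Ideal.primeCompl (𝔑'.comap (blowupAlgebraMap (algebraMap C (Localization.AtPrime 𝔮)) I
        (I.map (algebraMap C (Localization.AtPrime 𝔮))) (x i) le_rfl))) _ (inferInstance : IsNoetherianRing (blowupAlgebra I (x i)))
  have h2 := CompletedBaseChangeFibreStalks.isRegular_affineBlowup_maximalIdeal_of_isGRing_of_ringEquiv_adicCompletion hB' 𝔑' h1
    ê.symm
  exact CompletedBaseChangeFibrePoints.isRegular_affineBlowup_maximalIdeal_of_ringEquiv
    (R := Localization.AtPrime (𝔑'.comap (blowupAlgebraMap (algebraMap C (Localization.AtPrime 𝔮)) I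
      (I.map (algebraMap C (Localization.AtPrime 𝔮))) (x i) le_rfl)))
    (S := (affineBlowup I).presheaf.stalk z) e_z.symm h2

end Summit.ResolutionOfSingularities.ResolutionOfSingularities.Theorems.FRationalResolution.CompletedBaseChangeFibreDown

end
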